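import Summits.CriticalPhenomena.PercolationContinuityZ3.Theorems.PercNearOneGluingNoHeavyLowerTailSahiCombTriWAndClawCols

/-!
# AND with a claw block: `P₁ ∧ claw k` is an intersecting Kleitman shell whenever `P₁` is, for every `k ≥ 3`

Support file of the one-cut programme (crux `NoHeavyLowerTail`, stmt-CriticalPhenomena-4575; unit `prim-lf-1` gen 49).
Continuation of `…SahiCombTriWAndProd` (gen 41: `andProd`, the typed conjecture `AndShellLower`), of the `maj3` theorem
`…SahiCombTriWAndMaj3` (gen 43, the case `k = 3`) and of part 1 `…SahiCombTriWAndClawCols` (columns, sorted profiles, rearrangement).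

Setting: `P₁ ⊆ 2^{γ₁}` an antipode-free up-set with `Cor_{P₁}(U,V) ≥ 0` for all up-sets `U, V` (an INTERSECTING KLEITMAN SHELL), and
`claw k = {y ⊆ Fin k | k ≤ #y + 1}` = the top and the `k` co-atoms ("at least `k − 1` of `k`"; `claw 3 = maj3`, `claw 4` = the block
`e880 = (≥ 3 of 4)` of the unit's hard list).
* **`corP_andProd_claw_nonneg`** (`k ≥ 3`): `Cor_{P₁ ∧ claw k}(A,B) ≥ 0` for all up-sets `A, B` of the product cube `2^{γ₁ ⊕ Fin k}`
  (`…_of_four_le`: the new case `k ≥ 4`; `k = 3` is the `maj3` theorem; `…_of_klShell`: hypothesis in Kleitman-shell form).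
* **`sum_clawS_sq_le_corP_andProd_claw`** (`k ≥ 4`, the MAIN LEMMA): the stronger bound `Σ_{x∈P₁} s_{A,k-2}(x)s_{B,k-2}(x) ≤ Cor_{P₁ ∧ claw k}(A,B)`
  — the square of the second-largest sorted co-atom column is a SLACK of the certificate (consumed by the extension to blocks with further
  elements, `…SahiCombTriWAndClawPlus`).
* `klShell_andProd_claw`, **`triW_nonneg_andProd_claw`**: the AND-product is again an intersecting Kleitman shell and satisfies `TriWIneq` on
  every index cube; the statement ITERATES (`corP_andProd_claw_claw_nonneg`) and combines with the `maj3` / `or2` / cone / OR-product /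
  relabeling theorems; example `maj3 ∧ claw k` (`corP_maj3_andProd_claw_nonneg`).

Proof ("sorted profiles", part 1 notation; an INFINITE FAMILY with ONE certificate).  `Cor = Σ_{x∈P₁}[uu' + Σ_i w_iw'_i]`; pointwise
`Σ_i w_iw'_i ≥ Σ_j s_j s'_{k-1-j}` (rearrangement, `rearr_clawS`).  The MIDDLE products `s_j s'_{k-1-j}`, `2 ≤ j ≤ k-3`, are inner products of
unit `K`-vectors (both indices are non-minimal), hence `≥ 0` after summing over `P₁` (`sum_mul_nonneg_of_unit`).  The five extreme symbols
`a = s_0 ≤ b = s_1 ≤ c = s_{k-2} ≤ d = s_{k-1} ≤ u` carry the remaining `uu' + ad' + bc' + cb' + da'`, and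
`2(uu' + ad' + bc' + cb' + da') − 2cc' = [u(a'+b') + (a+b)u'] + [d(a'+b') + (a+b)d'] + [pointwise ≥ 0]` (`claw_cert_identity`,
found by an exact LP over the symbol cone; symmetric, the same for every `k ≥ 4`), where `c, d, u` are unit `K`-vectors and `a+b` is a
two-layer `K`-vector (`clawS_add_pair`), so the brackets and `Σ cc'` sum to `≥ 0` over `P₁` (`sum_mul_nonneg_of_two / _of_unit`).
* `lForm_le_scoreVal_secFAScore_of_corP_nonneg`: for an ANTIPODE-FREE block `Q` the lower bound of the typed conjecture `AndShellLower` is exactly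
  `Cor_{P₁ ∧ Q} ≥ 0`; instance `lForm_le_scoreVal_andProd_claw`.
HONEST LABEL: complete proofs, std axioms; a new infinite stratum of `TriWIneq` (all `P₁ ∧ claw k`, `k ≥ 3`, `P₁` any intersecting Kleitman
shell, and all iterates); the general AND conjecture `AndShellLower` stays OPEN. [this work]
-/

namespace Summit.CriticalPhenomena.PercolationContinuityZ3.Theorems

namespace FiveUpSet

open Finset

variable {γ₁ : Type} [DecidableEq γ₁] [Fintype γ₁] {k : ℕ}

/-! ### The five-symbol certificate -/

/-- The polynomial identity behind the certificate (symbols `a ≤ b ≤ c ≤ d ≤ u` on each side; found by an exact LP over the symbol cone,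
the same for every `k ≥ 4`): `2(uu' + ad' + bc' + cb' + da') − 2cc' = [u(a'+b') + (a+b)u'] + [d(a'+b') + (a+b)d'] + NN` with `NN` a
non-negative combination of products of differences. [this work] -/
theorem claw_cert_identity (u a b c d u' a' b' c' d' : ℤ) :
    2 * (u * u' + a * d' + b * c' + c * b' + d * a') - 2 * (c * c')
      = (u * (a' + b') + (a + b) * u' + d * (a' + b') + (a + b) * d')
        + ((b - a) * (u' - d') + (u - d) * (b' - a') + 2 * ((c - b) * (d' - c') + (d - c) * (c' - b'))
          + 2 * ((c - b) * (u' - d') + (u - d) * (c' - b')) + 2 * ((d - c) * (d' - c'))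
          + 2 * ((d - c) * (u' - d') + (u - d) * (d' - c')) + 2 * ((u - d) * (u' - d'))) := by
  ring

section mainthm
variable {P₁ : Finset (Finset γ₁)} (hP : IsUpperSet (P₁ : Set (Finset γ₁))) (hd : Disjoint P₁ (refl P₁))
  (hcor : ∀ U V : Finset (Finset γ₁), IsUpperSet (U : Set (Finset γ₁)) → IsUpperSet (V : Set (Finset γ₁)) → 0 ≤ corP P₁ U V)
  {A B : Finset (Finset (γ₁ ⊕ Fin k))} (hA : IsUpperSet (A : Set (Finset (γ₁ ⊕ Fin k)))) (hB : IsUpperSet (B : Set (Finset (γ₁ ⊕ Fin k))))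

include hA hB in
/-- **Pointwise certificate**: for indices `j0 ≤ j1 ≤ jc ≤ jd` the `K ⊗ K` part of the certificate is at most twice the five-term part of the
rearranged row minus twice the square term `s_{jc} s'_{jc}`. [this work] -/
theorem claw_five_cert {j0 j1 jc jd : Fin k} (h01 : j0 ≤ j1) (h1c : j1 ≤ jc) (hcd : jc ≤ jd) (x : Finset γ₁) :
    clawU A x * (clawS B x j0 + clawS B x j1) + (clawS A x j0 + clawS A x j1) * clawU B x
      + clawS A x jd * (clawS B x j0 + clawS B x j1) + (clawS A x j0 + clawS A x j1) * clawS B x jd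
    ≤ 2 * (clawU A x * clawU B x + clawS A x j0 * clawS B x jd + clawS A x j1 * clawS B x jc
      + clawS A x jc * clawS B x j1 + clawS A x jd * clawS B x j0) - 2 * (clawS A x jc * clawS B x jc) := by
  have hid := claw_cert_identity (clawU A x) (clawS A x j0) (clawS A x j1) (clawS A x jc) (clawS A x jd)
    (clawU B x) (clawS B x j0) (clawS B x j1) (clawS B x jc) (clawS B x jd)
  have ba : 0 ≤ clawS A x j1 - clawS A x j0 := sub_nonneg.2 (clawS_monotone A x h01)
  have cb : 0 ≤ clawS A x jc - clawS A x j1 := sub_nonneg.2 (clawS_monotone A x h1c)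
  have dc : 0 ≤ clawS A x jd - clawS A x jc := sub_nonneg.2 (clawS_monotone A x hcd)
  have ud : 0 ≤ clawU A x - clawS A x jd := sub_nonneg.2 (clawS_le_clawU hA x jd)
  have ba' : 0 ≤ clawS B x j1 - clawS B x j0 := sub_nonneg.2 (clawS_monotone B x h01)
  have cb' : 0 ≤ clawS B x jc - clawS B x j1 := sub_nonneg.2 (clawS_monotone B x h1c)
  have dc' : 0 ≤ clawS B x jd - clawS B x jc := sub_nonneg.2 (clawS_monotone B x hcd)
  have ud' : 0 ≤ clawU B x - clawS B x jd := sub_nonneg.2 (clawS_le_clawU hB x jd)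
  have n1 := mul_nonneg ba ud'; have n2 := mul_nonneg ud ba'; have n3 := mul_nonneg cb dc'; have n4 := mul_nonneg dc cb'
  have n5 := mul_nonneg cb ud'; have n6 := mul_nonneg ud cb'; have n7 := mul_nonneg dc dc'; have n8 := mul_nonneg dc ud'
  have n9 := mul_nonneg ud dc'; have n10 := mul_nonneg ud ud'
  linarith

include hP hd hcor hA hB in
/-- **Acuteness of the `K ⊗ K` part**: summed over `P₁` it is non-negative, provided `j1, jd` are not the minimum index
(`a + b = s_{j0} + s_{j1}` is a two-layer `K`-vector, `u` and `d = s_{jd}` are unit `K`-vectors; `sum_mul_nonneg_of_two`). [this work] -/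
theorem claw_KK_sum_nonneg {j0 j1 jd : Fin k} (hj1 : 1 ≤ (j1 : ℕ)) (hjd : 1 ≤ (jd : ℕ)) :
    0 ≤ ∑ x ∈ P₁, (clawU A x * (clawS B x j0 + clawS B x j1) + (clawS A x j0 + clawS A x j1) * clawU B x
      + clawS A x jd * (clawS B x j0 + clawS B x j1) + (clawS A x j0 + clawS A x j1) * clawS B x jd) := by
  simp only [sum_add_distrib]
  have bA2 : ∀ i j : Fin k, ∀ x ∈ P₁, -2 ≤ clawS A x i + clawS A x j ∧ clawS A x i + clawS A x j ≤ 2 := fun i j x _ => by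
    have := clawS_bounds A x i; have := clawS_bounds A x j; constructor <;> linarith
  have bB2 : ∀ i j : Fin k, ∀ x ∈ P₁, -2 ≤ clawS B x i + clawS B x j ∧ clawS B x i + clawS B x j ≤ 2 := fun i j x _ => by
    have := clawS_bounds B x i; have := clawS_bounds B x j; constructor <;> linarith
  have bA1 : ∀ j : Fin k, ∀ x ∈ P₁, -2 ≤ clawS A x j ∧ clawS A x j ≤ 2 := fun j x _ => by
    have := clawS_bounds A x j; constructor <;> linarith
  have bB1 : ∀ j : Fin k, ∀ x ∈ P₁, -2 ≤ clawS B x j ∧ clawS B x j ≤ 2 := fun j x _ => by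
    have := clawS_bounds B x j; constructor <;> linarith
  have bAu : ∀ x ∈ P₁, -2 ≤ clawU A x ∧ clawU A x ≤ 2 := fun x _ => by have := clawU_bounds (A := A) x; constructor <;> linarith
  have bBu : ∀ x ∈ P₁, -2 ≤ clawU B x ∧ clawU B x ≤ 2 := fun x _ => by have := clawU_bounds (A := B) x; constructor <;> linarith
  have t1 := sum_mul_nonneg_of_two hP hd hcor (fun x => clawU A x) (fun x => clawS B x j0 + clawS B x j1)
    bAu (bB2 j0 j1)
    (fun x _ x' _ h => clawU_mono hA h) (fun x _ x' _ h => add_le_add (clawS_mono hB h j0) (clawS_mono hB h j1))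
    (fun x _ x' _ h => clawU_add_clawU_nonneg hA h) (fun x _ x' _ h => clawS_add_pair hB h j0 j1 hj1)
  have t2 := sum_mul_nonneg_of_two hP hd hcor (fun x => clawS A x j0 + clawS A x j1) (fun x => clawU B x)
    (bA2 j0 j1) bBu
    (fun x _ x' _ h => add_le_add (clawS_mono hA h j0) (clawS_mono hA h j1)) (fun x _ x' _ h => clawU_mono hB h)
    (fun x _ x' _ h => clawS_add_pair hA h j0 j1 hj1) (fun x _ x' _ h => clawU_add_clawU_nonneg hB h)
  have t3 := sum_mul_nonneg_of_two hP hd hcor (fun x => clawS A x jd) (fun x => clawS B x j0 + clawS B x j1)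
    (bA1 jd) (bB2 j0 j1)
    (fun x _ x' _ h => clawS_mono hA h jd) (fun x _ x' _ h => add_le_add (clawS_mono hB h j0) (clawS_mono hB h j1))
    (fun x _ x' _ h => clawS_pair_self hA h jd hjd) (fun x _ x' _ h => clawS_add_pair hB h j0 j1 hj1)
  have t4 := sum_mul_nonneg_of_two hP hd hcor (fun x => clawS A x j0 + clawS A x j1) (fun x => clawS B x jd)
    (bA2 j0 j1) (bB1 jd)
    (fun x _ x' _ h => add_le_add (clawS_mono hA h j0) (clawS_mono hA h j1)) (fun x _ x' _ h => clawS_mono hB h jd)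
    (fun x _ x' _ h => clawS_add_pair hA h j0 j1 hj1) (fun x _ x' _ h => clawS_pair_self hB h jd hjd)
  linarith

include hP hd hcor hA hB in
/-- **MAIN LEMMA (claw block, `k ≥ 4`): the row sum dominates the square of the second-largest sorted column.**
`Σ_{x∈P₁} s_{A,k-2}(x) s_{B,k-2}(x) ≤ Cor_{P₁ ∧ claw k}(A,B)` for every antipode-free up-set `P₁` with `Cor_{P₁} ≥ 0` and all up-sets `A, B`.
(The slack term `s_{k-2} ⊗ s'_{k-2}` is what the extension by further block elements consumes.)  Proof: row decomposition, pointwise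
rearrangement, the middle products `s_j s'_{k-1-j}` (`2 ≤ j ≤ k-3`) are inner products of unit `K`-vectors, and the five extreme symbols
`s_0 ≤ s_1 ≤ s_{k-2} ≤ s_{k-1} ≤ u` are handled by `claw_cert_identity`. [this work] -/
theorem sum_clawS_sq_le_corP_andProd_claw (hk : 4 ≤ k) (jc : Fin k) (hjc : (jc : ℕ) = k - 2) :
    ∑ x ∈ P₁, clawS A x jc * clawS B x jc ≤ corP (andProd P₁ (claw k)) A B := by
  obtain ⟨j0, hj0⟩ : ∃ j : Fin k, (j : ℕ) = 0 := ⟨⟨0, by omega⟩, rfl⟩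
  obtain ⟨j1, hj1⟩ : ∃ j : Fin k, (j : ℕ) = 1 := ⟨⟨1, by omega⟩, rfl⟩
  obtain ⟨jd, hjd⟩ : ∃ j : Fin k, (j : ℕ) = k - 1 := ⟨⟨k - 1, by omega⟩, rfl⟩
  have r0 : Fin.rev j0 = jd := Fin.ext (by rw [Fin.val_rev]; omega)
  have r1 : Fin.rev j1 = jc := Fin.ext (by rw [Fin.val_rev]; omega)
  have rc : Fin.rev jc = j1 := Fin.ext (by rw [Fin.val_rev]; omega)
  have rd : Fin.rev jd = j0 := Fin.ext (by rw [Fin.val_rev]; omega)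
  have h01 : j0 ≤ j1 := Fin.le_iff_val_le_val.2 (by omega)
  have h1c : j1 ≤ jc := Fin.le_iff_val_le_val.2 (by omega)
  have hcd : jc ≤ jd := Fin.le_iff_val_le_val.2 (by omega)
  -- the four extreme indices as a set
  set S4 : Finset (Fin k) := {j0, j1, jc, jd} with hS4
  have n01 : j0 ≠ j1 := fun h => by have := congrArg Fin.val h; omega
  have n0c : j0 ≠ jc := fun h => by have := congrArg Fin.val h; omega
  have n0d : j0 ≠ jd := fun h => by have := congrArg Fin.val h; omega
  have n1c : j1 ≠ jc := fun h => by have := congrArg Fin.val h; omega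
  have n1d : j1 ≠ jd := fun h => by have := congrArg Fin.val h; omega
  have ncd : jc ≠ jd := fun h => by have := congrArg Fin.val h; omega
  have hsplit : ∀ f : Fin k → ℤ, ∑ j, f j = (∑ j ∈ univ \ S4, f j) + (f j0 + f j1 + f jc + f jd) := by
    intro f
    rw [← sum_sdiff (subset_univ S4), hS4, sum_insert, sum_insert, sum_insert, sum_singleton]
    · ring
    · rw [mem_singleton]; exact ncd
    · simp only [mem_insert, mem_singleton, not_or]; exact ⟨n1c, n1d⟩
    · simp only [mem_insert, mem_singleton, not_or]; exact ⟨n01, n0c, n0d⟩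
  have hmid : ∀ j ∈ univ \ S4, 1 ≤ (j : ℕ) ∧ 1 ≤ ((Fin.rev j : Fin k) : ℕ) := by
    intro j hj
    rw [mem_sdiff, hS4] at hj
    simp only [mem_insert, mem_singleton, not_or] at hj
    obtain ⟨-, hne0, -, -, hned⟩ := hj
    have h0 : (j : ℕ) ≠ 0 := fun h => hne0 (Fin.ext (by omega))
    have hd' : (j : ℕ) ≠ k - 1 := fun h => hned (Fin.ext (by omega))
    rw [Fin.val_rev]
    have := j.isLt
    omega
  rw [corP_andProd_claw_eq]
  -- (1) pointwise: five(x) + mid(x) ≤ row(x)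
  have step1 : ∀ x ∈ P₁,
      (clawU A x * clawU B x + clawS A x j0 * clawS B x jd + clawS A x j1 * clawS B x jc
        + clawS A x jc * clawS B x j1 + clawS A x jd * clawS B x j0)
      + ∑ j ∈ univ \ S4, clawS A x j * clawS B x (Fin.rev j)
      ≤ clawU A x * clawU B x + ∑ i : Fin k, clawW A i x * clawW B i x := by
    intro x _
    have hr := rearr_clawS A B x
    rw [hsplit (fun j => clawS A x j * clawS B x (Fin.rev j)), r0, r1, rc, rd] at hr
    linarith
  -- (2) the middle terms are inner products of unit K-vectors
  have step2 : 0 ≤ ∑ x ∈ P₁, ∑ j ∈ univ \ S4, clawS A x j * clawS B x (Fin.rev j) := by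
    rw [sum_comm]
    refine sum_nonneg fun j hj => ?_
    obtain ⟨hj, hjr⟩ := hmid j hj
    exact sum_mul_nonneg_of_unit hP hd hcor (fun x => clawS A x j) (fun x => clawS B x (Fin.rev j))
      (fun x _ => clawS_val A x j) (fun x _ => clawS_val B x (Fin.rev j))
      (fun x _ x' _ h => clawS_mono hA h j) (fun x _ x' _ h => clawS_mono hB h (Fin.rev j))
      (fun x _ x' _ h => clawS_pair_self hA h j hj) (fun x _ x' _ h => clawS_pair_self hB h (Fin.rev j) hjr)
  -- (3) the five-term part minus the square: certificate + acuteness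
  have step3 : ∑ x ∈ P₁, clawS A x jc * clawS B x jc
      ≤ ∑ x ∈ P₁, (clawU A x * clawU B x + clawS A x j0 * clawS B x jd + clawS A x j1 * clawS B x jc
        + clawS A x jc * clawS B x j1 + clawS A x jd * clawS B x j0) := by
    have hKK := claw_KK_sum_nonneg hP hd hcor hA hB (j0 := j0) (j1 := j1) (jd := jd) (by omega) (by omega)
    have hpt := sum_le_sum fun x (_ : x ∈ P₁) => claw_five_cert hA hB h01 h1c hcd x
    rw [sum_sub_distrib, ← mul_sum, ← mul_sum] at hpt
    linarith
  have hsum := sum_le_sum step1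
  rw [sum_add_distrib] at hsum
  linarith

include hP hd hcor hA hB in
/-- **THEOREM (AND with a claw block, `k ≥ 4`).**  If `P₁` is an antipode-free up-set with `Cor_{P₁} ≥ 0` on all pairs of up-sets, then
`Cor_{P₁ ∧ claw k}(A,B) ≥ 0` for all up-sets `A, B` of the product cube `2^{γ₁ ⊕ Fin k}` (main lemma + acuteness of the square term). [this work] -/
theorem corP_andProd_claw_nonneg_of_four_le (hk : 4 ≤ k) : 0 ≤ corP (andProd P₁ (claw k)) A B := by
  obtain ⟨jc, hjc⟩ : ∃ j : Fin k, (j : ℕ) = k - 2 := ⟨⟨k - 2, by omega⟩, rfl⟩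
  have h := sum_clawS_sq_le_corP_andProd_claw hP hd hcor hA hB hk jc hjc
  have hsq := sum_mul_nonneg_of_unit hP hd hcor (fun x => clawS A x jc) (fun x => clawS B x jc)
      (fun x _ => clawS_val A x jc) (fun x _ => clawS_val B x jc)
      (fun x _ x' _ h => clawS_mono hA h jc) (fun x _ x' _ h => clawS_mono hB h jc)
      (fun x _ x' _ h => clawS_pair_self hA h jc (by omega)) (fun x _ x' _ h => clawS_pair_self hB h jc (by omega))
  linarith

include hP hd hcor hA hB in
/-- **THEOREM (AND with a claw block, all `k ≥ 3`).**  For `k = 3` this is the `maj3` theorem (`claw 3 = maj3`). [this work] -/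
theorem corP_andProd_claw_nonneg (hk : 3 ≤ k) : 0 ≤ corP (andProd P₁ (claw k)) A B := by
  rcases Nat.lt_or_ge k 4 with h | h
  · have hk3 : k = 3 := by omega
    subst hk3
    rw [claw_three]
    exact corP_andProd_maj3_nonneg hP hd hcor hA hB
  · exact corP_andProd_claw_nonneg_of_four_le hP hd hcor hA hB h

end mainthm

/-! ### Corollaries -/

variable {β : Type} [DecidableEq β] [Fintype β]

/-- The same theorem with the hypothesis in Kleitman-shell form. [this work] -/
theorem corP_andProd_claw_nonneg_of_klShell (hk : 3 ≤ k) {P₁ : Finset (Finset γ₁)} (hP : IsUpperSet (P₁ : Set (Finset γ₁)))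
    (hd : Disjoint P₁ (refl P₁)) (hs : KlShell (P₁ ∪ refl P₁))
    {A B : Finset (Finset (γ₁ ⊕ Fin k))} (hA : IsUpperSet (A : Set (Finset (γ₁ ⊕ Fin k)))) (hB : IsUpperSet (B : Set (Finset (γ₁ ⊕ Fin k)))) :
    0 ≤ corP (andProd P₁ (claw k)) A B :=
  corP_andProd_claw_nonneg hP hd (fun U V hU hV => by rw [corP_eq_card_sub_card_of_disjoint hd]; exact hs U V hU hV) hA hB hk

/-- **The AND-product with a claw block is again an intersecting Kleitman shell.** [this work] -/
theorem klShell_andProd_claw (hk : 3 ≤ k) {P₁ : Finset (Finset γ₁)} (hP : IsUpperSet (P₁ : Set (Finset γ₁))) (hd : Disjoint P₁ (refl P₁))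
    (hcor : ∀ U V : Finset (Finset γ₁), IsUpperSet (U : Set (Finset γ₁)) → IsUpperSet (V : Set (Finset γ₁)) → 0 ≤ corP P₁ U V) :
    KlShell (andProd P₁ (claw k) ∪ refl (andProd P₁ (claw k))) :=
  klShell_of_corP_nonneg (disjoint_andProd_refl hd (claw k)) fun _ _ hA hB => corP_andProd_claw_nonneg hP hd hcor hA hB hk

/-- **`TriWIneq` for `P₁ ∧ claw k`** (`k ≥ 3`) on every index cube, for every intersecting Kleitman shell `P₁`. [this work] -/
theorem triW_nonneg_andProd_claw (hk : 3 ≤ k) {P₁ : Finset (Finset γ₁)} (hP : IsUpperSet (P₁ : Set (Finset γ₁))) (hd : Disjoint P₁ (refl P₁))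
    (hcor : ∀ U V : Finset (Finset γ₁), IsUpperSet (U : Set (Finset γ₁)) → IsUpperSet (V : Set (Finset γ₁)) → 0 ≤ corP P₁ U V)
    (F G : Finset β → Finset (Finset (γ₁ ⊕ Fin k)))
    (hF : ∀ x, IsUpperSet (F x : Set (Finset (γ₁ ⊕ Fin k)))) (hG : ∀ x, IsUpperSet (G x : Set (Finset (γ₁ ⊕ Fin k))))
    (hFm : Monotone F) (hGm : Monotone G) :
    0 ≤ triW (andProd P₁ (claw k)) F G :=
  triW_nonneg_of_corP_nonneg (isUpperSet_andProd hP isUpperSet_claw) (fun _ _ hA hB => corP_andProd_claw_nonneg hP hd hcor hA hB hk)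
    F G hF hG hFm hGm

/-! ### The typed conjecture `AndShellLower` for antipode-free blocks, and its instance `Q = claw k` -/

/-- For an ANTIPODE-FREE block `Q` the sectionwise Formula-A score of `P₁ ∧ Q` just counts `#(P₁ ∧ Q ∩ A ∩ B)`. [this work] -/
theorem scoreVal_secFAScore_of_disjoint {γ₂ : Type} [DecidableEq γ₂] [Fintype γ₂] (P₁ : Finset (Finset γ₁)) {Q : Finset (Finset γ₂)}
    (hQ : Disjoint Q (refl Q)) (A B : Finset (Finset (γ₁ ⊕ γ₂))) :
    scoreVal (secFAScore P₁ Q) A B = ((andProd P₁ Q ∩ A ∩ B).card : ℤ) := by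
  rw [scoreVal_secFAScore, card_andProd_inter_inter]
  refine sum_congr rfl fun x _ => ?_
  rw [disjoint_iff_inter_eq_empty.1 hQ, hQ.sdiff_eq_left]
  simp

/-- Hence, for an antipode-free block, the LOWER sandwich bound of `AndShellLower` is exactly `Cor_{P₁ ∧ Q}(A,B) ≥ 0`. [this work] -/
theorem lForm_le_scoreVal_secFAScore_of_corP_nonneg {γ₂ : Type} [DecidableEq γ₂] [Fintype γ₂] {P₁ : Finset (Finset γ₁)}
    {Q : Finset (Finset γ₂)} (hQ : Disjoint Q (refl Q)) {A B : Finset (Finset (γ₁ ⊕ γ₂))} (h : 0 ≤ corP (andProd P₁ Q) A B) :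
    lForm (andProd P₁ Q) A B ≤ scoreVal (secFAScore P₁ Q) A B := by
  rw [scoreVal_secFAScore_of_disjoint P₁ hQ, lForm_eq_card_sub_corP]
  linarith

/-- **`AndShellLower` for `Q = claw k` (`k ≥ 3`)**: the lower sandwich bound for `P₁ ∧ claw k`, every intersecting Kleitman shell `P₁`
(same shape as `lForm_le_scoreVal_andProd_or2 / _orAnd / _or3 / …`). [this work] -/
theorem lForm_le_scoreVal_andProd_claw (hk : 3 ≤ k) {P₁ : Finset (Finset γ₁)} (hP : IsUpperSet (P₁ : Set (Finset γ₁)))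
    (hd : Disjoint P₁ (refl P₁)) (hs : KlShell (P₁ ∪ refl P₁))
    {A B : Finset (Finset (γ₁ ⊕ Fin k))} (hA : IsUpperSet (A : Set (Finset (γ₁ ⊕ Fin k)))) (hB : IsUpperSet (B : Set (Finset (γ₁ ⊕ Fin k)))) :
    lForm (andProd P₁ (claw k)) A B ≤ scoreVal (secFAScore P₁ (claw k)) A B :=
  lForm_le_scoreVal_secFAScore_of_corP_nonneg (disjoint_claw_refl hk) (corP_andProd_claw_nonneg_of_klShell hk hP hd hs hA hB)

/-- Example: `maj3 ∧ claw k` (`k ≥ 3`), e.g. `maj3 ∧ (≥3 of 4)` (`n = 7`). [this work] -/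
theorem corP_maj3_andProd_claw_nonneg (hk : 3 ≤ k) {A B : Finset (Finset (Fin 3 ⊕ Fin k))}
    (hA : IsUpperSet (A : Set (Finset (Fin 3 ⊕ Fin k)))) (hB : IsUpperSet (B : Set (Finset (Fin 3 ⊕ Fin k)))) :
    0 ≤ corP (andProd maj3 (claw k)) A B :=
  corP_andProd_claw_nonneg isUpperSet_maj3 disjoint_maj3_refl (fun _ _ hU hV => corP_nonneg_of_selfDual maj3_selfDual hU hV) hA hB hk

/-- Iteration: `(P₁ ∧ claw k) ∧ claw k'` is again certified (the theorem feeds itself and the `maj3` / `or2` / cone theorems). [this work] -/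
theorem corP_andProd_claw_claw_nonneg {k' : ℕ} (hk : 3 ≤ k) (hk' : 3 ≤ k') {P₁ : Finset (Finset γ₁)} (hP : IsUpperSet (P₁ : Set (Finset γ₁)))
    (hd : Disjoint P₁ (refl P₁))
    (hcor : ∀ U V : Finset (Finset γ₁), IsUpperSet (U : Set (Finset γ₁)) → IsUpperSet (V : Set (Finset γ₁)) → 0 ≤ corP P₁ U V)
    {A B : Finset (Finset ((γ₁ ⊕ Fin k) ⊕ Fin k'))}
    (hA : IsUpperSet (A : Set (Finset ((γ₁ ⊕ Fin k) ⊕ Fin k')))) (hB : IsUpperSet (B : Set (Finset ((γ₁ ⊕ Fin k) ⊕ Fin k')))) :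
    0 ≤ corP (andProd (andProd P₁ (claw k)) (claw k')) A B :=
  corP_andProd_claw_nonneg (isUpperSet_andProd hP isUpperSet_claw) (disjoint_andProd_refl hd (claw k))
    (fun _ _ hU hV => corP_andProd_claw_nonneg hP hd hcor hU hV hk) hA hB hk'

end FiveUpSet

end Summit.CriticalPhenomena.PercolationContinuityZ3.Theorems
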